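import Mathlib
import HarnessLib

/-!
# Finite cyclic semigroups: index, period, and the structure theorem

Source: O. Ganyushkin, V. Mazorchuk, *Classical Finite Transformation Semigroups*, Algebra and
Applications 9, Springer (2009) [GanyushkinMazorchuk2009], §5.2 "Cyclic subsemigroups":
formula (5.2) in the proof of Lemma 5.2.1, Lemma 5.2.5, Corollary 5.2.6, the remark after it
(uniqueness of the idempotent), and Theorem 5.2.7 (structure theorem for finite cyclic
semigroups) (i), (iv), (v).

An element `a` of a semigroup has *type* `(k, m)` (index `k`, period `m`) if
`a, a², …, a^{k+m-1}` are pairwise different and `a^{k+m} = a^k`.  We work in a monoid `M`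
(the book's `S¹`) with natural powers; the basic hypothesis is the period relation
`a ^ (k + m) = a ^ k` with `0 < m`, and "pairwise different" enters, where needed, as
injectivity of `i ↦ a^{k+i}` on `i < m`.  No definitions are introduced; the subgroup
`P = {a^k, …, a^{k+m-1}}` is the set `{x | ∃ n, k ≤ n ∧ x = a ^ n}` and its identity is
written `e = a^{km}`.

* periodicity: `a^{n + cm} = a^n` for `n ≥ k`, and `a^s = a^t` whenever `s, t ≥ k`,
  `s ≡ t (mod m)` (`pow_add_mul_period`, `pow_eq_pow_of_modEq`) — formula (5.2)
  (`pow_mul_pow_eq_pow_mod`);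
* Theorem 5.2.7 (i): `⟨a⟩ = {a, …, a^{k+m-1}}` (`powers_eq`);
* Lemma 5.2.5 / Theorem 5.2.7 (iv): `P` is closed under multiplication, `e = a^{km}` is its
  identity and an idempotent, every element of `P` has an inverse in `P`, and
  `j ↦ a^{j + km}` is a bijection `ℤ_m → P` turning addition into multiplication
  (`mul_mem_P`, `P_eq`, `identity_P`, `isIdempotentElem_pow_mul`, `inverse_P`, `zmodMap_add`,
  `zmodMap_bijOn`) — i.e. `P ≅ (ℤ_m, +)`;
* Corollary 5.2.6: in a finite monoid every element has an idempotent positive power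
  (`exists_isIdempotentElem_pow`); Theorem 5.2.7 (v) / the remark after Corollary 5.2.6: the
  idempotent of `⟨a⟩` is unique (`idempotent_pow_unique`).

(Mathlib has the compact-semigroup version of Corollary 5.2.6, the Ellis–Numakura lemma
`exists_idempotent_of_compact_t2_of_continuous_mul_left`; the elementary finite statement with
an explicit power is recorded here as printed.)
-/

namespace Literature.Algebra.Semigroups

variable {M : Type*} [Monoid M] {a : M} {k m : ℕ}

/-! ### Periodicity of powers: formula (5.2) -/

/-- If `a^{k+m} = a^k` then `a^{n+cm} = a^n` for all `n ≥ k` and all `c`.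
[cite: GanyushkinMazorchuk2009, Lemma 5.2.1] -/
theorem pow_add_mul_period (hper : a ^ (k + m) = a ^ k) {n : ℕ} (hn : k ≤ n) (c : ℕ) :
    a ^ (n + c * m) = a ^ n := by
  obtain ⟨d, rfl⟩ := Nat.exists_eq_add_of_le hn
  induction c with
  | zero => simp
  | succ c ih =>
    calc a ^ (k + d + (c + 1) * m) = a ^ (k + m) * a ^ (d + c * m) := by
          rw [← pow_add]; congr 1; ring
      _ = a ^ (k + d + c * m) := by rw [hper, ← pow_add]; congr 1; ring
      _ = a ^ (k + d) := ih

/-- Formula (5.2): if `a^{k+m} = a^k` then `a^s = a^t` whenever `s, t ≥ k` and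
`s ≡ t (mod m)`. [cite: GanyushkinMazorchuk2009, Lemma 5.2.1] -/
theorem pow_eq_pow_of_modEq (hper : a ^ (k + m) = a ^ k) {s t : ℕ} (hs : k ≤ s) (ht : k ≤ t)
    (hst : s ≡ t [MOD m]) : a ^ s = a ^ t := by
  wlog hle : s ≤ t generalizing s t
  · exact (this ht hs hst.symm (le_of_not_ge hle)).symm
  obtain ⟨c, hc⟩ := (Nat.modEq_iff_dvd' hle).1 hst
  have htc : t = m * c + s := Nat.eq_add_of_sub_eq hle hc
  rw [htc, add_comm, mul_comm, pow_add_mul_period hper hs]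

/-- The representative exponent: `k + ((x - k) mod m) ≡ x (mod m)` for `x ≥ k`. [folklore] -/
private theorem rep_modEq {x : ℕ} (hx : k ≤ x) : k + (x - k) % m ≡ x [MOD m] := by
  show (k + (x - k) % m) % m = x % m
  rw [Nat.add_mod, Nat.mod_mod, ← Nat.add_mod, Nat.add_sub_cancel' hx]

/-- Formula (5.2), second case: for `s + t ≥ k` the product `a^s a^t` equals
`a^{k + ((s+t-k) mod m)}`. [cite: GanyushkinMazorchuk2009, Lemma 5.2.1] -/
theorem pow_mul_pow_eq_pow_mod (hper : a ^ (k + m) = a ^ k) {s t : ℕ} (h : k ≤ s + t) :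
    a ^ s * a ^ t = a ^ (k + (s + t - k) % m) := by
  rw [← pow_add]
  exact pow_eq_pow_of_modEq hper h (Nat.le_add_right _ _) (rep_modEq h).symm

/-- **Theorem 5.2.7 (i)**: if `a^{k+m} = a^k` with `m > 0` (and `k ≥ 1`) then every positive
power of `a` is one of `a, a², …, a^{k+m-1}`: `⟨a⟩ = {a^i : 1 ≤ i < k + m}`.
[cite: GanyushkinMazorchuk2009, Theorem 5.2.7 (i)] -/
theorem powers_eq (hm : 0 < m) (hper : a ^ (k + m) = a ^ k) (hk : 1 ≤ k) :
    {x : M | ∃ n, 1 ≤ n ∧ x = a ^ n} = {x : M | ∃ i, 1 ≤ i ∧ i < k + m ∧ x = a ^ i} := by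
  refine Set.Subset.antisymm ?_ ?_
  · rintro _ ⟨n, hn, rfl⟩
    by_cases hnk : n < k + m
    · exact ⟨n, hn, hnk, rfl⟩
    · have hlt : (n - k) % m < m := Nat.mod_lt _ hm
      exact ⟨k + (n - k) % m, by omega, by omega,
        pow_eq_pow_of_modEq hper (by omega) (Nat.le_add_right _ _) (rep_modEq (by omega)).symm⟩
  · rintro _ ⟨i, hi, -, rfl⟩
    exact ⟨i, hi, rfl⟩

/-! ### Lemma 5.2.5: the group `P = {a^k, …, a^{k+m-1}}` -/

/-- **Lemma 5.2.5**: `P = {aⁿ : n ≥ k}` is closed under multiplication.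
[cite: GanyushkinMazorchuk2009, Lemma 5.2.5] -/
theorem mul_mem_P {x y : M} (hx : x ∈ {x : M | ∃ n, k ≤ n ∧ x = a ^ n})
    (hy : y ∈ {x : M | ∃ n, k ≤ n ∧ x = a ^ n}) :
    x * y ∈ {x : M | ∃ n, k ≤ n ∧ x = a ^ n} := by
  obtain ⟨s, hs, rfl⟩ := hx
  obtain ⟨t, ht, rfl⟩ := hy
  exact ⟨s + t, by omega, (pow_add a s t).symm⟩

/-- With `m > 0`, `P = {aⁿ : n ≥ k}` consists of the `m` powers `a^k, …, a^{k+m-1}`.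
[cite: GanyushkinMazorchuk2009, Lemma 5.2.5] -/
theorem P_eq (hm : 0 < m) (hper : a ^ (k + m) = a ^ k) :
    {x : M | ∃ n, k ≤ n ∧ x = a ^ n} = {x : M | ∃ i, i < m ∧ x = a ^ (k + i)} := by
  refine Set.Subset.antisymm ?_ ?_
  · rintro _ ⟨n, hn, rfl⟩
    exact ⟨(n - k) % m, Nat.mod_lt _ hm,
      pow_eq_pow_of_modEq hper hn (Nat.le_add_right _ _) (rep_modEq hn).symm⟩
  · rintro _ ⟨i, -, rfl⟩
    exact ⟨k + i, Nat.le_add_right _ _, rfl⟩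

/-- **Lemma 5.2.5** (identity): for `m > 0`, `e = a^{km}` lies in `P` and is a two-sided
identity of `P` (it is the idempotent `a^{k + (-k mod m)}` of the remark after
Corollary 5.2.6). [cite: GanyushkinMazorchuk2009, Lemma 5.2.5] -/
theorem identity_P (hm : 0 < m) (hper : a ^ (k + m) = a ^ k) :
    a ^ (k * m) ∈ {x : M | ∃ n, k ≤ n ∧ x = a ^ n} ∧
      ∀ x ∈ {x : M | ∃ n, k ≤ n ∧ x = a ^ n}, a ^ (k * m) * x = x ∧ x * a ^ (k * m) = x := by
  refine ⟨⟨k * m, Nat.le_mul_of_pos_right k hm, rfl⟩, ?_⟩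
  rintro _ ⟨n, hn, rfl⟩
  rw [← pow_add, ← pow_add, add_comm (k * m) n]
  exact ⟨pow_add_mul_period hper hn k, pow_add_mul_period hper hn k⟩

/-- **Corollary 5.2.6** (the idempotent of `⟨a⟩`): if `a^{k+m} = a^k` with `m > 0` then
`e = a^{km}` is an idempotent. [cite: GanyushkinMazorchuk2009, Corollary 5.2.6] -/
theorem isIdempotentElem_pow_mul (hm : 0 < m) (hper : a ^ (k + m) = a ^ k) :
    IsIdempotentElem (a ^ (k * m)) :=
  ((identity_P hm hper).2 _ (identity_P hm hper).1).1

/-- **Lemma 5.2.5** (inverses): every element `aⁿ`, `n ≥ k`, of `P` has an inverse in `P`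
with respect to the identity `e = a^{km}` (namely `a^{(m-1)n + km}`).
[cite: GanyushkinMazorchuk2009, Lemma 5.2.5] -/
theorem inverse_P (hm : 0 < m) (hper : a ^ (k + m) = a ^ k) {x : M}
    (hx : x ∈ {x : M | ∃ n, k ≤ n ∧ x = a ^ n}) :
    ∃ y ∈ {x : M | ∃ n, k ≤ n ∧ x = a ^ n}, x * y = a ^ (k * m) ∧ y * x = a ^ (k * m) := by
  obtain ⟨n, hn, rfl⟩ := hx
  have hkm : k ≤ k * m := Nat.le_mul_of_pos_right k hm
  refine ⟨a ^ ((m - 1) * n + k * m), ⟨_, by omega, rfl⟩, ?_⟩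
  -- `n + ((m-1)n + km) = (n + k) m ≡ 0 ≡ km (mod m)`
  have hsum : n + ((m - 1) * n + k * m) = (n + k) * m := by
    obtain ⟨m', rfl⟩ : ∃ m', m = m' + 1 := Nat.exists_eq_add_one_of_ne_zero hm.ne'
    simp only [Nat.add_sub_cancel]
    ring
  have hmod : n + ((m - 1) * n + k * m) ≡ k * m [MOD m] := by
    rw [hsum]
    exact (Nat.modEq_zero_iff_dvd.2 (dvd_mul_left m _)).trans
      (Nat.modEq_zero_iff_dvd.2 (dvd_mul_left m _)).symm
  have key := pow_eq_pow_of_modEq hper (by omega) hkm hmod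
  refine ⟨by rw [← pow_add, key], by rw [← pow_add, add_comm, key]⟩

/-- **Lemma 5.2.5 / Theorem 5.2.7 (iv)** (the isomorphism `P ≅ ℤ_m`, additivity): for
`m > 0` the map `j ↦ a^{j + km}` from `ZMod m` satisfies `φ(i + j) = φ(i) φ(j)` (and
`φ(0) = e = a^{km}`). [cite: GanyushkinMazorchuk2009, Lemma 5.2.5] -/
theorem zmodMap_add [NeZero m] (hper : a ^ (k + m) = a ^ k) (i j : ZMod m) :
    a ^ ((i + j).val + k * m) = a ^ (i.val + k * m) * a ^ (j.val + k * m) := by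
  rw [← pow_add]
  refine pow_eq_pow_of_modEq hper (Nat.le_add_left _ _ |>.trans' (Nat.le_mul_of_pos_right k
    (Nat.pos_of_ne_zero (NeZero.ne m)))) (by
      have := Nat.le_mul_of_pos_right k (Nat.pos_of_ne_zero (NeZero.ne m)); omega) ?_
  show ((i + j).val + k * m) % m = (i.val + k * m + (j.val + k * m)) % m
  rw [ZMod.val_add, Nat.add_mul_mod_self_right, Nat.mod_mod,
    show i.val + k * m + (j.val + k * m) = i.val + j.val + (k + k) * m by ring,
    Nat.add_mul_mod_self_right]

/-- **Lemma 5.2.5 / Theorem 5.2.7 (iv)** (the isomorphism `P ≅ ℤ_m`, bijectivity): if `a` has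
type `(k, m)` — `a^{k+m} = a^k` and `a^k, …, a^{k+m-1}` pairwise different — then
`j ↦ a^{j + km}` is a bijection from `ZMod m` onto `P = {aⁿ : n ≥ k}`.
[cite: GanyushkinMazorchuk2009, Lemma 5.2.5] -/
theorem zmodMap_bijOn [NeZero m] (hper : a ^ (k + m) = a ^ k)
    (hdist : ∀ i j, i < m → j < m → a ^ (k + i) = a ^ (k + j) → i = j) :
    Set.BijOn (fun j : ZMod m => a ^ (j.val + k * m)) Set.univ
      {x : M | ∃ n, k ≤ n ∧ x = a ^ n} := by
  have hm : 0 < m := Nat.pos_of_ne_zero (NeZero.ne m)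
  have hkm : k ≤ k * m := Nat.le_mul_of_pos_right k hm
  -- every `a^x`, `x ≥ k`, equals the representative `a^{k + ((x - k) mod m)}`
  have hrep : ∀ {x : ℕ}, k ≤ x → a ^ x = a ^ (k + (x - k) % m) := fun hx =>
    pow_eq_pow_of_modEq hper hx (Nat.le_add_right _ _) (rep_modEq hx).symm
  refine Set.BijOn.mk (fun j _ => ⟨j.val + k * m, by omega, rfl⟩) ?_ ?_
  · intro i _ j _ h
    have h' : a ^ (i.val + k * m) = a ^ (j.val + k * m) := h
    rw [hrep (by omega : k ≤ i.val + k * m), hrep (by omega : k ≤ j.val + k * m)] at h'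
    have h1 := hdist _ _ (Nat.mod_lt _ hm) (Nat.mod_lt _ hm) h'
    -- `(i + km - k) ≡ (j + km - k) (mod m)` gives `i ≡ j (mod m)`
    have h2 : i.val + k * m - k ≡ j.val + k * m - k [MOD m] := h1
    have h3 := Nat.ModEq.add_right k h2
    rw [Nat.sub_add_cancel (by omega), Nat.sub_add_cancel (by omega)] at h3
    have h4 : i.val ≡ j.val [MOD m] := Nat.ModEq.add_right_cancel' (k * m) h3
    exact ZMod.val_injective m (Nat.ModEq.eq_of_lt_of_lt h4 (ZMod.val_lt i) (ZMod.val_lt j))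
  · rintro _ ⟨n, hn, rfl⟩
    refine ⟨(n : ZMod m), Set.mem_univ _, ?_⟩
    show a ^ ((n : ZMod m).val + k * m) = a ^ n
    rw [ZMod.val_natCast]
    refine pow_eq_pow_of_modEq hper (by omega) hn ?_
    show (n % m + k * m) % m = n % m
    rw [Nat.add_mul_mod_self_right, Nat.mod_mod]

/-! ### Corollary 5.2.6 and Theorem 5.2.7 (v) -/

/-- **Corollary 5.2.6**: in a finite monoid every element has an idempotent positive power —
some `aⁱ = aʲ` with `i < j` by finiteness, so `a` has a period `p = j - i` from `i` on, and
`a^{(i+1)p}` is idempotent. [cite: GanyushkinMazorchuk2009, Corollary 5.2.6] -/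
theorem exists_isIdempotentElem_pow [Finite M] (a : M) :
    ∃ n, 1 ≤ n ∧ IsIdempotentElem (a ^ n) := by
  obtain ⟨i, j, hne, hij⟩ := Finite.exists_ne_map_eq_of_infinite (fun n : ℕ => a ^ n)
  wlog hlt : i < j generalizing i j
  · exact this j i hne.symm hij.symm (lt_of_le_of_ne (le_of_not_gt hlt) hne.symm)
  obtain ⟨c, rfl⟩ := Nat.exists_eq_add_of_lt hlt
  -- period relation `a^{i + (c+1)} = a^i`
  have hper : a ^ (i + (c + 1)) = a ^ i := by rw [← add_assoc]; exact hij.symm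
  have hi : i ≤ (i + 1) * (c + 1) := (Nat.le_succ i).trans (Nat.le_mul_of_pos_right _ c.succ_pos)
  refine ⟨(i + 1) * (c + 1), Nat.one_le_iff_ne_zero.2 (by positivity), ?_⟩
  show a ^ ((i + 1) * (c + 1)) * a ^ ((i + 1) * (c + 1)) = a ^ ((i + 1) * (c + 1))
  rw [← pow_add]
  refine pow_eq_pow_of_modEq hper (by omega) hi ?_
  exact (Nat.modEq_zero_iff_dvd.2 (dvd_add (dvd_mul_left _ _) (dvd_mul_left _ _))).trans
    (Nat.modEq_zero_iff_dvd.2 (dvd_mul_left _ _)).symm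

/-- **Theorem 5.2.7 (v)** (and the remark after Corollary 5.2.6): the idempotent of `⟨a⟩` is
unique — if `a^{k+m} = a^k`, `m > 0`, and a positive power `a^s` is idempotent, then
`a^s = a^{km}`. [cite: GanyushkinMazorchuk2009, Theorem 5.2.7 (v)] -/
theorem idempotent_pow_unique (hm : 0 < m) (hper : a ^ (k + m) = a ^ k) {s : ℕ} (hs : 1 ≤ s)
    (h : IsIdempotentElem (a ^ s)) : a ^ s = a ^ (k * m) := by
  -- `a^s = (a^s)^N = a^{sN}` with `N = m(k+1)`, and `sN ≥ k`, `sN ≡ 0 ≡ km (mod m)`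
  have hN : m * (k + 1) ≠ 0 := by positivity
  rw [← h.pow_eq hN, ← pow_mul]
  have h1 : k + 1 ≤ m * (k + 1) := Nat.le_mul_of_pos_left _ hm
  have h2 : m * (k + 1) ≤ s * (m * (k + 1)) := Nat.le_mul_of_pos_left _ hs
  refine pow_eq_pow_of_modEq hper (by omega) (Nat.le_mul_of_pos_right k hm) ?_
  exact (Nat.modEq_zero_iff_dvd.2 (dvd_mul_of_dvd_right (dvd_mul_right m _) s)).trans
    (Nat.modEq_zero_iff_dvd.2 (dvd_mul_left m k)).symm

end Literature.Algebra.Semigroups
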